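import Literature.AlgebraicGeometry.HodgeTheory.HodgeSectionRestrictionTriangulable
import Literature.AlgebraicGeometry.HodgeTheory.HardLefschetzNFold
import Literature.AlgebraicGeometry.HodgeTheory.HodgeIndexPrimitiveAlgebraic
import Literature.AlgebraicGeometry.HodgeTheory.HodgeFiltrationModels
import Literature.AlgebraicGeometry.Motives.ComplexPointsManifold
import Literature.AlgebraicTopology.SingularHomology.CupProductProofs
import HarnessLib

/-!
# The perfect pairing on middle-degree Hodge classes from hard Lefschetz and Hodge–Riemann (BFNP 2009, §6 (6.1)), and Lemma 50 from it

Family `hodge`, layer `Literature/AlgebraicGeometry/HodgeTheory`. Third companion of the named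
fact `hodgeSectionRestriction_of_hodgeConjectureFor` (file `HodgeSectionRestriction`; P. Brosnan,
H. Fang, Z. Nie, G. Pearlstein, *Singularities of admissible normal functions*, Invent. Math. 177
(2009), §6 Lemma 50, arXiv:0711.0964 p. 13), after `HodgeSectionRestrictionProofs` (the printed
proof relative to (P) = the perfect pairing on `Hdg^n` and (T)/(LC) = tautness / local
contractibility of `Zᵢ(ℂ)`) and `HodgeSectionRestrictionTriangulable` ((LC) from the semialgebraic
triangulation theorem `OhmotoShiota2017_c1Triangulation`). This file formalises the one sentence of
the printed proof that was still a bare hypothesis, (P):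

> "By Poincaré duality and the Hodge–Riemann bilinear relations, the cup product pairing
> `Hᵏ(Y) ⊗ H^{2n-k}(Y) → H^{2n}(Y)` restricts to give a perfect pairing
> `Hdg^k Y ⊗ Hdg^{dim Y - k} Y → ℚ`  (6.1)"  (BFNP §6, p. 13, before Lemma 48; used in the proof of
> Lemma 50 with `dim Y = 2n`, `k = n`: "there exists an element `α ∈ Hdg^{2n}(X)` such that
> `0 ≠ α ∪ ζ`").

The classical argument behind the sentence (C. Voisin, *Hodge Theory and Complex Algebraic Geometry
I*, §6.2.3 and §6.3.2): by hard Lefschetz (Thm. 6.25) `H^{2n}(X, ℚ) = ⊕_r Lʳ P^{2n-2r}` (Lefschetz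
decomposition, Cor. 6.26, defined over `ℚ` since `L = [H] ∪ ·` is, §7.1.2, and compatible with the
Hodge decomposition, Rem. 6.27), the pieces are mutually orthogonal for `(a, b) ↦ ∫ a ∪ b`, and on
the real primitive `(m,m)`-classes `y ∈ P^{2m}`, `m + r = n`, the form `(-1)^m ∫ L^{2r} y ∪ y` is
positive definite (Hodge–Riemann bilinear relations, Thm. 6.32); hence the form is non-degenerate
on `Hdg^n = H^{2n}(X, ℚ) ∩ H^{n,n}` (a rational `(n,n)`-class has rational `(n-r, n-r)` Lefschetz
components). ALL PROVED here on the tree's carriers (`complexBetti X k = Hᵏ(X(ℂ); ℂ)`,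
`IsRationalClass`, `IsOfHodgeType`, the Alexander–Whitney `cupProduct` and its Lefschetz iterates
`lefschetzPowTo`), relative to EXISTING statements of the tree as hypotheses — no named fact is
introduced (D-0026) and `hodgeSectionRestriction_of_hodgeConjectureFor` is not discharged:

* (S1) **Cup-product algebra of the Lefschetz operator** (from the tree's PROVED `cupProduct_assoc`
  and `cupProduct_gradedComm_holds`, Hatcher §3.2 p. 211, Thm. 3.11): `(Lu) ∪ v = L(u ∪ v) = u ∪ (Lv)`,
  their iterates, `Lⁱ ∘ Lʲ = L^{i+j}`, and `(Lⁱ u) ∪ (Lʲ v) = u ∪ (L^{i+j} v)`.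
* (S2) **The Lefschetz decomposition step** from a hard Lefschetz datum `Λ : HardLefschetzNFold d X`
  (file `HardLefschetzNFold`: the class `[H]`, rational, of bidegree `(1,1)`, with `L^{d-k} : Hᵏ ≅ H^{2d-k}`
  bijective and detecting rationality and Hodge type), pure linear algebra:
  `HardLefschetzNFold.exists_eq_primitive_add_lefschetzOperator` — every `x ∈ Hˡ`, `l ≤ d`, is
  `x = x₀ + Lβ` with `x₀` primitive (`L^{d-l+1} x₀ = 0`) and `β = (L^{d-l+2})⁻¹ (L^{d-l+1} x)`;
  `x` rational ⇒ `x₀`, `β` rational; `x` of type `(p+1, q+1)` ⇒ `β` of type `(p, q)` and `x₀` of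
  type `(p+1, q+1)` IN ONE HODGE MODEL — this needs the tree's named fact
  `hodgePQ_independent_of_hodgeModel` (file `HodgeFiltrationModels`) as a hypothesis, because
  `IsOfHodgeType` quantifies `∃` over Hodge models and is not additive without it.
* (S3) **The perfect pairing** `HardLefschetzNFold.exists_rational_hodge_cup_ne_zero`: for `X`
  smooth projective of dimension `2n` with hard Lefschetz datum `Λ` satisfying the HODGE–RIEMANN
  ANISOTROPY — for `m + r = n` and `y ∈ H^{2m}(X(ℂ); ℂ)` rational of type `(m,m)` with
  `L^{2r+1} y = 0` and `y ≠ 0`: `Lʳ y ∪ Lʳ y ≠ 0 ∈ H^{4n}(X(ℂ); ℂ)` (Thm. 6.32 for real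
  `(m,m)`-classes, SIGN-FREE as in `hodgeIndex_surface`: the tree fixes no orientation
  `H^{4n}(X(ℂ); ℂ) ≅ ℂ`; for `r = 0` and algebraic `y` this is Hartshorne App. A Thm. 5.2) — every
  non-zero rational `(n,n)`-class `c` has a rational `(n,n)` partner `a` with `c ∪ a ≠ 0`. Proof
  (`exists_cup_lefschetzPow_ne_zero`, induction on `m` for classes `Lʳ x`, `x ∈ H^{2m}`): write
  `x = x₀ + Lβ`; if `x₀ ≠ 0` the partner is `Lʳ x₀` (the cross term `L^{r+1}β ∪ Lʳ x₀ = β ∪ L^{2r+1} x₀`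
  vanishes — orthogonality of the Lefschetz pieces — and `Lʳ x₀ ∪ Lʳ x₀ ≠ 0` by Hodge–Riemann);
  if `x₀ = 0` then `Lʳ x = L^{r+1} β` with `β ≠ 0` rational of type `(m-1, m-1)`. The base `m = 0`
  uses `H^{4n+2}(X(ℂ); ℂ) = 0` (`Motives.ComplexPoints.subsingleton_singularCohomology_of_lt`, PROVED).
* (S4) **Glue**: `pairing_of_hardLefschetz_hodgeRiemann` ((P) for all `2n`-folds from the datum for
  all `2n`-folds); `hodgeSectionRestriction_of_hodgeConjectureFor_of_hardLefschetz_hodgeRiemann_of_c1Triangulation`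
  — THE NAMED FACT from (i) `hodgePQ_independent_of_hodgeModel`, (ii) for every smooth projective
  `2n`-fold a hard Lefschetz datum with the Hodge–Riemann anisotropy, (iii)
  `OhmotoShiota2017_c1Triangulation`; the variant with (LC) of the supports in place of (iii); and
  the fourfold case for one `X` (`sectionRestriction_fourfold_of_hardLefschetz_hodgeRiemann_of_c1Triangulation`).
* (S5) **The pairing with an ALGEBRAIC partner, without `hodgePQ_independent_of_hodgeModel`**
  (`HardLefschetzNFold.exists_algebraic_cup_lefschetzPow_ne_zero`, `…exists_algebraic_cup_ne_zero`):
  BFNP's Lemma 50 ASSUMES the Hodge conjecture for `X` (all codimensions), so rational `(p,p)`-classes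
  of `X` are algebraic; running the induction of (S3) with the invariants "rational of type `(m,m)`"
  for `x`, `β` (transported through the bijections `L^{2r+2}`) and "rational and ALGEBRAIC" for the
  difference `x₀ = x - Lβ` (`Nᵖ H²ᵖ` is a submodule stable under `L`) needs no comparison of Hodge
  models, and needs positivity only on primitive ALGEBRAIC classes — Grothendieck's standard
  conjecture of Hodge type `Hdg(X)` for `[H]`, a THEOREM over `ℂ` (Kleiman 1968 §3; Murre, Torino
  lectures §7.7: "in characteristic zero (HStC) is true by Hodge theory for the classical cohomology";
  middle degree = Hartshorne App. A Thm. 5.2), rendered sign-free: `x` rational, algebraic, primitive,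
  non-zero ⟹ `x ∪ Lʳ x ≠ 0`. The partner produced is algebraic (`a ∈ Nⁿ H^{2n}`), which is what the
  topological core consumes. Glue: `hodgeSectionRestriction_of_hodgeConjectureFor_of_hodgeIndex_of_c1Triangulation`
  — THE NAMED FACT from (ii') "every smooth projective `2n`-fold carries a hard Lefschetz datum with the
  Hodge index property on primitive algebraic classes" and (iii) `OhmotoShiota2017_c1Triangulation`
  ONLY; the variant with (LC) of the supports; the fourfold case.
* (S6) **From named facts only** (needs the file `HodgeIndexPrimitiveAlgebraic`):
  `hodgeSectionRestriction_of_hodgeConjectureFor_of_hodgeIndexFact_of_c1Triangulation` — the fact from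
  `hodgeIndex_primitiveAlgebraic` (all `n`, `X`) and `OhmotoShiota2017_c1Triangulation`; the (LC)-supports
  variant; the fourfold case from `hodgeIndex_primitiveAlgebraic 4 X`.

## Faithfulness of hypothesis (ii)

(ii) is the Kähler package of `X ⊂ ℙᴺ` for the hyperplane class `[H] = c₁(𝒪_X(1))` (Voisin I
Thm. 7.10: `X^an` is Kähler with integral class `[ω] = [H]`): hard Lefschetz (Thm. 6.25, Rem. 6.27,
§7.1.2 — exactly the content of the tree's named fact `nonempty_hardLefschetzNFold (2n) X`) AND, for
the same class, the Hodge–Riemann relation of Thm. 6.32 ("the form `(-1)^{k(k-1)/2} i^{p-q-k} H_k` is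
positive definite on `H^{p,q}_prim`", `H_k(α, β) = iᵏ ∫ ω^{N-k} ∧ α ∧ β̄`) specialised to `k = 2m`,
`p = q = m`, real (rational) `α = β = y`: `∫ L^{2r} y ∪ y ≠ 0`, i.e. `Lʳ y ∪ Lʳ y ≠ 0` (cup ↔ wedge
under de Rham, `H^{4n}(X(ℂ); ℂ) ≅ ℂ` by integration) — a consequence WEAKER than print. It is stated
as a hypothesis (an `∃ Λ, …` clause), not vendored as a named fact (D-0026: this unit may not mint
one); the two hypotheses hard Lefschetz and Hodge–Riemann must concern the SAME class, which is why
they are bundled (Hodge–Riemann fails for an arbitrary class with the hard Lefschetz property).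

## What is NOT here

* The discharge of (ii) (harmonic theory on `X^an`, Voisin I Ch. 5–6) and of
  `hodgePQ_independent_of_hodgeModel`, `OhmotoShiota2017_c1Triangulation` (named facts of the tree).
* The full Lefschetz decomposition as a direct sum and its uniqueness (only the one-step splitting
  `x = x₀ + Lβ` with its rationality / type bookkeeping is needed and proved).

## References

* [BrosnanFangNiePearlstein2009] P. Brosnan, H. Fang, Z. Nie, G. Pearlstein, Singularities of
  admissible normal functions, Invent. Math. 177 (2009) 599–629, §6 display (6.1) and Lemma 50
  (arXiv:0711.0964, p. 13).
* [VoisinHodgeI2002] C. Voisin, Hodge Theory and Complex Algebraic Geometry I (CUP 2002), §6.2.3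
  Prop. 6.22, Def. 6.24, Thm. 6.25, Cor. 6.26, Rem. 6.27; §6.3.2 Thm. 6.32; §7.1.2; §7.1.3 Thm. 7.10.
* [Hartshorne1977] R. Hartshorne, Algebraic Geometry (1977), App. A Thm. 5.2 (Hodge index theorem).
* [Kleiman1968] S. L. Kleiman, Algebraic cycles and the Weil conjectures, in: Dix exposés sur la
  cohomologie des schémas (North-Holland 1968), §3 (the standard conjecture of Hodge type `Hdg(X)`).
* [MurreTorino1994] J. P. Murre, Algebraic cycles and algebraic aspects of cohomology and K-theory,
  in: Algebraic Cycles and Hodge Theory (Torino 1993), LNM 1594 (1994), §7.7.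
* [HatcherAT2002] A. Hatcher, Algebraic Topology (CUP 2002), §3.2 p. 211, Thm. 3.11, Thm. 3.26(c).
* [OhmotoShiota2017] T. Ohmoto, M. Shiota, `C¹`-triangulations of semialgebraic sets, J. Topol. 10
  (2017), Thm. 1.1.
-/

noncomputable section

open CategoryTheory

universe u v

namespace Literature.AlgebraicGeometry.HodgeTheory

section HodgeTheory

open Literature.AlgebraicTopology.SingularHomology Literature.Geometry.Kaehler

/-! ### Cup-product algebra of the Lefschetz operator -/

section CupAlgebra

variable {Y : Type u} [TopologicalSpace Y] {R : Type v} [CommRing R]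
variable (κ : singularCohomology R R Y 2)

/-- `(κ ∪ u) ∪ v = κ ∪ (u ∪ v)`: the Lefschetz operator commutes with right multiplication
(associativity of the cup product). [cite: HatcherAT2002, §3.2 p. 211] -/
theorem cupProduct_lefschetzOperator_left {k l q s t : ℕ} (hkl : 2 + k = l) (hls : l + q = s)
    (hkq : k + q = t) (hts : 2 + t = s) (u : singularCohomology R R Y k)
    (v : singularCohomology R R Y q) :
    cupProduct hls (lefschetzOperator κ hkl u) v = lefschetzOperator κ hts (cupProduct hkq u v) := by
  simp only [lefschetzOperator_apply]
  exact cupProduct_assoc hkl hkq hls hts κ u v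

/-- `u ∪ (κ ∪ v) = κ ∪ (u ∪ v)`: the Lefschetz operator commutes with left multiplication
(associativity and graded commutativity of the cup product, `κ` of even degree).
[cite: HatcherAT2002, §3.2 p. 211 and Thm. 3.11] -/
theorem cupProduct_lefschetzOperator_right {p k l s t : ℕ} (hkl : 2 + k = l) (hps : p + l = s)
    (hpk : p + k = t) (hts : 2 + t = s) (u : singularCohomology R R Y p)
    (v : singularCohomology R R Y k) :
    cupProduct hps u (lefschetzOperator κ hkl v) = lefschetzOperator κ hts (cupProduct hpk u v) := by
  simp only [lefschetzOperator_apply]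
  have hp2 : p + 2 = p + 2 := rfl
  have h2p : 2 + p = p + 2 := by omega
  have hm : p + 2 + k = s := by omega
  rw [← cupProduct_assoc hp2 hkl hm hps u κ v, cupProduct_gradedComm_holds R Y hp2 h2p u κ]
  have hsign : ((-1 : R) ^ (p * 2)) = 1 := by
    rw [mul_comm, pow_mul, neg_one_sq, one_pow]
  rw [hsign, one_smul]
  exact cupProduct_assoc h2p hpk hm hts κ u v

/-- `(Lⁱ u) ∪ v = Lⁱ (u ∪ v)` (explicit degrees). [cite: HatcherAT2002, §3.2 p. 211] -/
theorem cupProduct_lefschetzPowTo_left (i : ℕ) :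
    ∀ {k m q s t : ℕ} (hm : k + 2 * i = m) (hs : m + q = s) (hkq : k + q = t) (ht : t + 2 * i = s)
      (u : singularCohomology R R Y k) (v : singularCohomology R R Y q),
      cupProduct hs (lefschetzPowTo κ i k m hm u) v = lefschetzPowTo κ i t s ht (cupProduct hkq u v) := by
  induction i with
  | zero =>
    intro k m q s t hm hs hkq ht u v
    subst hm
    subst hkq
    subst ht
    rfl
  | succ i ih =>
    intro k m q s t hm hs hkq ht u v
    rw [lefschetzPowTo_succ_apply κ i k (k + 2 * i) m rfl hm (by omega) u,
      lefschetzPowTo_succ_apply κ i t (t + 2 * i) s rfl ht (by omega),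
      cupProduct_lefschetzOperator_left κ (by omega) hs (by omega : k + 2 * i + q = t + 2 * i)
        (by omega),
      ih rfl (by omega) hkq rfl u v]

/-- `u ∪ (Lⁱ v) = Lⁱ (u ∪ v)` (explicit degrees). [cite: HatcherAT2002, §3.2 p. 211 and Thm. 3.11] -/
theorem cupProduct_lefschetzPowTo_right (i : ℕ) :
    ∀ {p k m s t : ℕ} (hm : k + 2 * i = m) (hs : p + m = s) (hpk : p + k = t) (ht : t + 2 * i = s)
      (u : singularCohomology R R Y p) (v : singularCohomology R R Y k),
      cupProduct hs u (lefschetzPowTo κ i k m hm v) = lefschetzPowTo κ i t s ht (cupProduct hpk u v) := by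
  induction i with
  | zero =>
    intro p k m s t hm hs hpk ht u v
    subst hm
    subst hpk
    subst ht
    rfl
  | succ i ih =>
    intro p k m s t hm hs hpk ht u v
    rw [lefschetzPowTo_succ_apply κ i k (k + 2 * i) m rfl hm (by omega) v,
      lefschetzPowTo_succ_apply κ i t (t + 2 * i) s rfl ht (by omega),
      cupProduct_lefschetzOperator_right κ (by omega) hs (by omega : p + (k + 2 * i) = t + 2 * i)
        (by omega),
      ih rfl (by omega) hpk rfl u v]

/-- Exponent bookkeeping: `Lⁱ = L^{i'}` for `i = i'` (same source and target degrees). [folklore] -/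
theorem lefschetzPowTo_congr_exponent {i i' k s : ℕ} (hi : i = i') (h : k + 2 * i = s)
    (h' : k + 2 * i' = s) (w : singularCohomology R R Y k) :
    lefschetzPowTo κ i k s h w = lefschetzPowTo κ i' k s h' w := by
  subst hi
  rfl

/-- `Lⁱ (Lʲ w) = L^{j+i} w` (explicit degrees). [cite: VoisinHodgeI2002, §6.2.3] -/
theorem lefschetzPowTo_lefschetzPowTo (i : ℕ) :
    ∀ {j k m s : ℕ} (hm : k + 2 * j = m) (hs : m + 2 * i = s) (hs' : k + 2 * (j + i) = s)
      (w : singularCohomology R R Y k),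
      lefschetzPowTo κ i m s hs (lefschetzPowTo κ j k m hm w) = lefschetzPowTo κ (j + i) k s hs' w := by
  induction i with
  | zero =>
    intro j k m s hm hs hs' w
    subst hm
    subst hs
    rfl
  | succ i ih =>
    intro j k m s hm hs hs' w
    rw [lefschetzPowTo_succ_apply κ i m (m + 2 * i) s rfl hs (by omega),
      ih hm rfl (by omega) w,
      ← lefschetzPowTo_succ_apply κ (j + i) k (m + 2 * i) s (by omega) (by omega) (by omega) w]
    exact lefschetzPowTo_congr_exponent κ (by omega) _ _ w

/-- `Lʲ (κ ∪ w) = L^{j+1} w` (explicit degrees). [cite: VoisinHodgeI2002, §6.2.3] -/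
theorem lefschetzPowTo_lefschetzOperator (j : ℕ) {k l s : ℕ} (hkl : 2 + k = l) (hs : l + 2 * j = s)
    (hs' : k + 2 * (j + 1) = s) (w : singularCohomology R R Y k) :
    lefschetzPowTo κ j l s hs (lefschetzOperator κ hkl w) = lefschetzPowTo κ (j + 1) k s hs' w := by
  have h1 : lefschetzOperator κ hkl w = lefschetzPowTo κ 1 k l (by omega) w := by
    rw [lefschetzPowTo_succ_apply κ 0 k k l rfl (by omega) hkl, lefschetzPowTo_zero_apply]
  rw [h1, lefschetzPowTo_lefschetzPowTo κ j (by omega) hs (by omega) w]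
  exact lefschetzPowTo_congr_exponent κ (by omega) _ _ w

/-- `(Lⁱ u) ∪ (Lʲ v) = u ∪ (L^{i+j} v)` (explicit degrees): all powers of the hyperplane class may
be moved onto one factor. [cite: HatcherAT2002, §3.2 p. 211 and Thm. 3.11] -/
theorem cupProduct_lefschetzPowTo_lefschetzPowTo (i j : ℕ) {p k a b s c : ℕ} (ha : p + 2 * i = a)
    (hb : k + 2 * j = b) (hs : a + b = s) (hc : k + 2 * (i + j) = c) (hs' : p + c = s)
    (u : singularCohomology R R Y p) (v : singularCohomology R R Y k) :
    cupProduct hs (lefschetzPowTo κ i p a ha u) (lefschetzPowTo κ j k b hb v) =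
      cupProduct hs' u (lefschetzPowTo κ (i + j) k c hc v) := by
  rw [cupProduct_lefschetzPowTo_left κ i ha hs (by omega : p + b = p + b) (by omega) u,
    cupProduct_lefschetzPowTo_right κ j hb rfl (rfl : p + k = p + k) (by omega) u v,
    lefschetzPowTo_lefschetzPowTo κ i (by omega) (by omega) (by omega),
    cupProduct_lefschetzPowTo_right κ (i + j) hc hs' rfl (by omega) u v]
  exact lefschetzPowTo_congr_exponent κ (by omega) _ _ _

end CupAlgebra

/-! ### The Lefschetz decomposition step from hard Lefschetz -/

section LefschetzDecomposition

variable {d : ℕ} {X : Motives.SchemeOver ℂ}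

/-- Rational classes are closed under subtraction (`c - c' = c + (-1) • c'`).
[cite: HatcherAT2002, §3.1] -/
private theorem isRationalClass_sub {Y : Type} [TopologicalSpace Y] {k : ℕ}
    {c c' : singularCohomology ℂ ℂ Y k} (hc : IsRationalClass c) (hc' : IsRationalClass c') :
    IsRationalClass (c - c') := by
  have h := hc.add (hc'.smul (-1))
  simpa [sub_eq_add_neg] using h

/-- **The Lefschetz decomposition step** (Voisin I, proof of Prop. 6.22 / Cor. 6.26 read through
hard Lefschetz, Thm. 6.25): on an `X` carrying the hard Lefschetz datum `Λ` in dimension `d`, for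
`l = k + 2` with `k + (j + 1) = d` (i.e. `l ≤ d`, `j = d - l + 1`), every `x ∈ Hˡ(X(ℂ); ℂ)` is
`x = x₀ + L β` with `β ∈ Hᵏ` and `x₀` PRIMITIVE, `Lʲ x₀ = L^{d-l+1} x₀ = 0`: take for `β` the
preimage of `Lʲ x` under the bijection `L^{j+1} : Hᵏ → H^{2d-k}`. The construction preserves
rationality (`L^{j+1}` is bijective on rational classes, `Λ.isRationalClass_L_iff`) and, in any one
Hodge model `A`, Hodge types: `x` of type `(p+1, q+1)` gives `β` of type `(p, q)` and `x₀` of type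
`(p+1, q+1)` (`L` has bidegree `(1,1)` and `L^{j+1}` detects types, `Λ.isOfHodgeType_L_iff`; the
passage between Hodge models is the tree's named fact `hodgePQ_independent_of_hodgeModel`, needed
because `IsOfHodgeType` quantifies `∃` over models and `x₀ = x - Lβ` is a difference).
[cite: VoisinHodgeI2002, §6.2.3 Prop. 6.22, Thm. 6.25, Cor. 6.26 and Rem. 6.27] -/
theorem HardLefschetzNFold.exists_eq_primitive_add_lefschetzOperator (Λ : HardLefschetzNFold d X)
    {k j l t : ℕ} (hjk : k + (j + 1) = d) (hkl : 2 + k = l) (ht : l + 2 * j = t)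
    (x : complexBetti X l) :
    ∃ (x₀ : complexBetti X l) (β : complexBetti X k),
      x = x₀ + lefschetzOperator Λ.hyperplaneClass hkl β ∧
      Λ.L j l t ht x₀ = 0 ∧
      (IsRationalClass x → IsRationalClass x₀ ∧ IsRationalClass β) ∧
      (∀ (A : HodgeModel d X) (p q : ℕ), hodgePQ_independent_of_hodgeModel →
        Motives.IsSmoothProjective d X →
        A.pullback l x ∈ A.hodgePQ l (p + 1) (q + 1) →
          A.pullback l x₀ ∈ A.hodgePQ l (p + 1) (q + 1) ∧ A.pullback k β ∈ A.hodgePQ k p q) := by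
  have ht' : k + 2 * (j + 1) = t := by omega
  -- `β = (L^{j+1})⁻¹ (Lʲ x)` (hard Lefschetz: `L^{j+1} : Hᵏ → H^{2d-k}` is bijective)
  obtain ⟨β, hβ⟩ := (Λ.bijective_L hjk t ht').2 (Λ.L j l t ht x)
  have hLβ : Λ.L j l t ht (lefschetzOperator Λ.hyperplaneClass hkl β) = Λ.L j l t ht x := by
    rw [← hβ]
    exact lefschetzPowTo_lefschetzOperator Λ.hyperplaneClass j hkl ht ht' β
  refine ⟨x - lefschetzOperator Λ.hyperplaneClass hkl β, β, (sub_add_cancel _ _).symm, ?_, ?_, ?_⟩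
  · -- `x₀ = x - Lβ` is primitive
    rw [map_sub, hLβ, sub_self]
  · -- rationality
    intro hx
    have hy : IsRationalClass (Λ.L (j + 1) k t ht' β) := hβ ▸ Λ.isRationalClass_L j l t ht hx
    have hβQ : IsRationalClass β := (Λ.isRationalClass_L_iff hjk t ht' β).1 hy
    have hLβQ : IsRationalClass (lefschetzOperator Λ.hyperplaneClass hkl β) :=
      Λ.isRationalClass_hyperplaneClass.cup hkl hβQ
    exact ⟨isRationalClass_sub hx hLβQ, hβQ⟩
  · -- Hodge types in the model `A`
    intro A p q hI hX hxA
    have hxT : IsOfHodgeType d X l (p + 1) (q + 1) x := ⟨A, hxA⟩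
    have hyT : IsOfHodgeType d X t (p + 1 + j) (q + 1 + j) (Λ.L (j + 1) k t ht' β) :=
      hβ ▸ Λ.isOfHodgeType_L j l t ht (p + 1) (q + 1) hxT
    have hβT : IsOfHodgeType d X k p q β := by
      refine (Λ.isOfHodgeType_L_iff hjk t ht' p q β).1 ?_
      rwa [show p + (j + 1) = p + 1 + j by omega, show q + (j + 1) = q + 1 + j by omega]
    have hβA : A.pullback k β ∈ A.hodgePQ k p q :=
      (hodgePQ_independent_of_hodgeModel.isOfHodgeType_iff hI hX A).1 hβT
    have hLβT : IsOfHodgeType d X l (p + 1) (q + 1) (lefschetzOperator Λ.hyperplaneClass hkl β) :=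
      Λ.isOfHodgeType_lefschetzOperator k l hkl p q β hβT
    have hLβA : A.pullback l (lefschetzOperator Λ.hyperplaneClass hkl β) ∈ A.hodgePQ l (p + 1) (q + 1) :=
      (hodgePQ_independent_of_hodgeModel.isOfHodgeType_iff hI hX A).1 hLβT
    refine ⟨?_, hβA⟩
    rw [map_sub]
    exact Submodule.sub_mem _ hxA hLβA

end LefschetzDecomposition

/-! ### The perfect pairing (6.1) from hard Lefschetz and Hodge–Riemann -/

section Pairing

variable {n : ℕ} {X : Motives.SchemeOver ℂ}

/-- **Non-degeneracy of the cup product on rational `(n,n)`-classes along the Lefschetz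
decomposition** (the induction behind BFNP's "(6.1) is perfect by Poincaré duality and the
Hodge–Riemann bilinear relations"). Let `X` be smooth projective of dimension `2n` with hard
Lefschetz datum `Λ` (`L = [H] ∪ ·`), fix a Hodge model `A`, and assume the HODGE–RIEMANN
ANISOTROPY for `Λ`: for `m + r = n` and `y ∈ H^{2m}(X(ℂ); ℂ)` rational of type `(m, m)` and
primitive (`L^{2r+1} y = 0`), `y ≠ 0` implies `Lʳ y ∪ Lʳ y ≠ 0` (Voisin I Thm. 6.32 for real
`(m,m)`-classes: `(-1)^m ∫ L^{2r} y ∪ y > 0`; sign-free). Then for every `m + r = n` and every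
non-zero rational `x ∈ H^{2m}` of type `(m, m)` (in `A`) there is a rational `(n, n)`-class `a` with
`Lʳ x ∪ a ≠ 0`. Induction on `m`: write `x = x₀ + Lβ` with `x₀` primitive
(`exists_eq_primitive_add_lefschetzOperator`); if `x₀ ≠ 0` take `a = Lʳ x₀` — the cross term
`L^{r+1} β ∪ Lʳ x₀ = β ∪ L^{2r+1} x₀` vanishes and `Lʳ x₀ ∪ Lʳ x₀ ≠ 0` by Hodge–Riemann; if `x₀ = 0`
then `Lʳ x = L^{r+1} β` and the induction hypothesis applies to `β ≠ 0`. (Base `m = 0`: every class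
in `H⁰` is primitive since `H^{4n+2}(X(ℂ); ℂ) = 0`.)
[cite: VoisinHodgeI2002, §6.2.3 Cor. 6.26 and §6.3.2 Thm. 6.32]
[cite: BrosnanFangNiePearlstein2009, §6 display (6.1)] -/
theorem HardLefschetzNFold.exists_cup_lefschetzPow_ne_zero
    (hX : Motives.IsSmoothProjective (2 * n) X) (Λ : HardLefschetzNFold (2 * n) X)
    (hI : hodgePQ_independent_of_hodgeModel)
    (hHR : ∀ (m r : ℕ) (hmr : m + r = n) (y : complexBetti X (2 * m)), IsRationalClass y →
      IsOfHodgeType (2 * n) X (2 * m) m m y →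
      Λ.L (2 * r + 1) (2 * m) (2 * m + 2 * (2 * r + 1)) rfl y = 0 → y ≠ 0 →
      cupProduct (rfl : 2 * n + 2 * n = 2 * n + 2 * n)
        (Λ.L r (2 * m) (2 * n) (by omega) y) (Λ.L r (2 * m) (2 * n) (by omega) y) ≠ 0)
    (A : HodgeModel (2 * n) X) :
    ∀ (m r : ℕ) (hmr : m + r = n) (x : complexBetti X (2 * m)), IsRationalClass x →
      A.pullback (2 * m) x ∈ A.hodgePQ (2 * m) m m → x ≠ 0 →
      ∃ a : complexBetti X (2 * n), IsRationalClass a ∧ IsOfHodgeType (2 * n) X (2 * n) n n a ∧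
        cupProduct (rfl : 2 * n + 2 * n = 2 * n + 2 * n) (Λ.L r (2 * m) (2 * n) (by omega) x) a ≠ 0 := by
  intro m
  induction m with
  | zero =>
    intro r hmr x hxQ hxA hx0
    obtain rfl : r = n := by omega
    -- every class of `H⁰` is primitive: `H^{4r+2}(X(ℂ); ℂ) = 0`
    have hprim : Λ.L (2 * r + 1) (2 * 0) (2 * 0 + 2 * (2 * r + 1)) rfl x = 0 := by
      haveI := Motives.ComplexPoints.subsingleton_singularCohomology_of_lt hX ℂ
        (k := 2 * 0 + 2 * (2 * r + 1)) (by omega)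
      exact Subsingleton.elim _ _
    have hxT : IsOfHodgeType (2 * r) X (2 * 0) 0 0 x := ⟨A, hxA⟩
    refine ⟨Λ.L r (2 * 0) (2 * r) (by omega) x, Λ.isRationalClass_L _ _ _ _ hxQ, ?_,
      hHR 0 r (by omega) x hxQ hxT hprim hx0⟩
    have := Λ.isOfHodgeType_L r (2 * 0) (2 * r) (by omega) 0 0 hxT
    simpa only [Nat.zero_add] using this
  | succ m ih =>
    intro r hmr x hxQ hxA hx0
    -- the Lefschetz decomposition step: `x = x₀ + Lβ`, `L^{2r+1} x₀ = 0`
    obtain ⟨x₀, β, hx, hprim, hQ, hT⟩ := Λ.exists_eq_primitive_add_lefschetzOperator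
      (k := 2 * m) (j := 2 * r + 1) (l := 2 * (m + 1)) (t := 2 * (m + 1) + 2 * (2 * r + 1))
      (by omega) (by omega) rfl x
    obtain ⟨hx₀Q, hβQ⟩ := hQ hxQ
    obtain ⟨hx₀A, hβA⟩ := hT A m m hI hX hxA
    by_cases hx₀ : x₀ = 0
    · -- `x = Lβ`, `β ≠ 0`: induction
      subst hx₀
      rw [zero_add] at hx
      have hβ0 : β ≠ 0 := by
        rintro rfl
        exact hx0 (by rw [hx, map_zero])
      obtain ⟨a, haQ, haT, hne⟩ := ih (r + 1) (by omega) β hβQ hβA hβ0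
      refine ⟨a, haQ, haT, ?_⟩
      rw [hx]
      simp only [HardLefschetzNFold.L] at hne ⊢
      rwa [lefschetzPowTo_lefschetzOperator Λ.hyperplaneClass r (by omega) (by omega) (by omega) β]
    · -- `x₀ ≠ 0`: the partner is `Lʳ x₀`
      have hx₀T : IsOfHodgeType (2 * n) X (2 * (m + 1)) (m + 1) (m + 1) x₀ := ⟨A, hx₀A⟩
      set a := Λ.L r (2 * (m + 1)) (2 * n) (by omega) x₀ with ha
      have haQ : IsRationalClass a := Λ.isRationalClass_L _ _ _ _ hx₀Q
      have haT : IsOfHodgeType (2 * n) X (2 * n) n n a := by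
        have := Λ.isOfHodgeType_L r (2 * (m + 1)) (2 * n) (by omega) (m + 1) (m + 1) hx₀T
        rwa [hmr] at this
      have hHRx₀ := hHR (m + 1) r hmr x₀ hx₀Q hx₀T hprim hx₀
      refine ⟨a, haQ, haT, ?_⟩
      -- `Lʳ x = a + L^{r+1} β`
      have hLx : Λ.L r (2 * (m + 1)) (2 * n) (by omega) x =
          a + Λ.L (r + 1) (2 * m) (2 * n) (by omega) β := by
        rw [hx, map_add, ha]
        simp only [HardLefschetzNFold.L]
        rw [lefschetzPowTo_lefschetzOperator Λ.hyperplaneClass r (by omega) (by omega) (by omega) β]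
      -- the cross term `L^{r+1} β ∪ Lʳ x₀ = β ∪ L^{2r+1} x₀ = 0`
      have hcross : cupProduct (rfl : 2 * n + 2 * n = 2 * n + 2 * n)
          (Λ.L (r + 1) (2 * m) (2 * n) (by omega) β) a = 0 := by
        rw [ha]
        simp only [HardLefschetzNFold.L] at hprim ⊢
        rw [cupProduct_lefschetzPowTo_lefschetzPowTo Λ.hyperplaneClass (r + 1) r (by omega) (by omega)
            rfl (by omega : 2 * (m + 1) + 2 * (r + 1 + r) = 2 * (m + 1) + 2 * (2 * r + 1))
            (by omega) β x₀,
          lefschetzPowTo_congr_exponent Λ.hyperplaneClass (by omega : r + 1 + r = 2 * r + 1) _ rfl x₀,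
          hprim, map_zero]
      rw [hLx, map_add, LinearMap.add_apply, hcross, add_zero]
      exact hHRx₀

/-- **The perfect pairing (6.1) on middle-degree Hodge classes from hard Lefschetz and
Hodge–Riemann** (BFNP §6: "By Poincaré duality and the Hodge–Riemann bilinear relations, the cup
product pairing `Hᵏ(Y) ⊗ H^{2n-k}(Y) → H^{2n}(Y)` restricts to give a perfect pairing
`Hdg^k Y ⊗ Hdg^{dim Y - k} Y → ℚ` (6.1)", here `dim Y = 2n`, `k = n`). For `X` smooth projective of
dimension `2n` with hard Lefschetz datum `Λ` satisfying the Hodge–Riemann anisotropy on rational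
primitive `(m,m)`-classes (as in `exists_cup_lefschetzPow_ne_zero`), every non-zero rational class
`c ∈ H^{2n}(X(ℂ); ℂ)` of type `(n, n)` has a rational `(n, n)` partner `a` with `c ∪ a ≠ 0` — the
hypothesis (P) of `hodgeSectionRestriction_of_hodgeConjectureFor_of_pairing_of_c1Triangulation`.
[cite: BrosnanFangNiePearlstein2009, §6 display (6.1)]
[cite: VoisinHodgeI2002, Thm. 6.25, Cor. 6.26 and Thm. 6.32] -/
theorem HardLefschetzNFold.exists_rational_hodge_cup_ne_zero
    (hX : Motives.IsSmoothProjective (2 * n) X) (Λ : HardLefschetzNFold (2 * n) X)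
    (hI : hodgePQ_independent_of_hodgeModel)
    (hHR : ∀ (m r : ℕ) (hmr : m + r = n) (y : complexBetti X (2 * m)), IsRationalClass y →
      IsOfHodgeType (2 * n) X (2 * m) m m y →
      Λ.L (2 * r + 1) (2 * m) (2 * m + 2 * (2 * r + 1)) rfl y = 0 → y ≠ 0 →
      cupProduct (rfl : 2 * n + 2 * n = 2 * n + 2 * n)
        (Λ.L r (2 * m) (2 * n) (by omega) y) (Λ.L r (2 * m) (2 * n) (by omega) y) ≠ 0)
    (c : complexBetti X (2 * n)) (hc : IsRationalClass c) (hH : IsOfHodgeType (2 * n) X (2 * n) n n c)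
    (hne : c ≠ 0) :
    ∃ a : complexBetti X (2 * n), IsRationalClass a ∧ IsOfHodgeType (2 * n) X (2 * n) n n a ∧
      cupProduct (rfl : 2 * n + 2 * n = 2 * n + 2 * n) c a ≠ 0 := by
  obtain ⟨A, hcA⟩ := hH
  exact Λ.exists_cup_lefschetzPow_ne_zero hX hI hHR A n 0 (by omega) c hc hcA hne

end Pairing

/-! ### Lemma 50 from hard Lefschetz + Hodge–Riemann and the triangulation theorem -/

section Glue

variable {X : Motives.SchemeOver ℂ}

/-- **(P) for all even-dimensional smooth projective varieties from the Kähler package of the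
hyperplane class.** Granted, for every smooth projective `X` of dimension `2n ≥ 2`, a hard
Lefschetz datum `Λ` for `X` (Voisin I Thm. 6.25 with Rem. 6.27 and §7.1.2 — the content of the
tree's named fact `nonempty_hardLefschetzNFold (2n) X`) whose class `[H]` moreover satisfies the
Hodge–Riemann anisotropy on rational primitive `(m,m)`-classes (Thm. 6.32: for `y ∈ H^{2m}(X, ℝ)`
primitive of type `(m,m)`, `y ≠ 0`, `(-1)^m ∫_X L^{2n-2m} y ∪ y > 0`; rendered sign-free as
`Lʳ y ∪ Lʳ y ≠ 0`, `m + r = n`), and the independence of Hodge types from the Hodge model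
(`hodgePQ_independent_of_hodgeModel`), the cup-product pairing on the rational `(n,n)`-classes of
`H^{2n}(X(ℂ); ℂ)` is non-degenerate for every such `X` (`HardLefschetzNFold.exists_rational_hodge_cup_ne_zero`).
[cite: BrosnanFangNiePearlstein2009, §6 display (6.1)] [cite: VoisinHodgeI2002, Thm. 6.25 and Thm. 6.32] -/
theorem pairing_of_hardLefschetz_hodgeRiemann (hI : hodgePQ_independent_of_hodgeModel)
    (hHLR : ∀ ⦃n : ℕ⦄ ⦃X : Motives.SchemeOver ℂ⦄, 0 < n → Motives.IsSmoothProjective (2 * n) X →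
      ∃ Λ : HardLefschetzNFold (2 * n) X,
        ∀ (m r : ℕ) (hmr : m + r = n) (y : complexBetti X (2 * m)), IsRationalClass y →
          IsOfHodgeType (2 * n) X (2 * m) m m y →
          Λ.L (2 * r + 1) (2 * m) (2 * m + 2 * (2 * r + 1)) rfl y = 0 → y ≠ 0 →
          cupProduct (rfl : 2 * n + 2 * n = 2 * n + 2 * n)
            (Λ.L r (2 * m) (2 * n) (by omega) y) (Λ.L r (2 * m) (2 * n) (by omega) y) ≠ 0) :
    ∀ ⦃n : ℕ⦄ ⦃X : Motives.SchemeOver ℂ⦄, 0 < n → Motives.IsSmoothProjective (2 * n) X →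
      ∀ c : complexBetti X (2 * n), IsRationalClass c → IsOfHodgeType (2 * n) X (2 * n) n n c →
        c ≠ 0 → ∃ a : complexBetti X (2 * n), IsRationalClass a ∧
          IsOfHodgeType (2 * n) X (2 * n) n n a ∧
          cupProduct (rfl : 2 * n + 2 * n = 2 * n + 2 * n) c a ≠ 0 := by
  intro n X hn hX c hc hH hne
  obtain ⟨Λ, hHR⟩ := hHLR hn hX
  exact Λ.exists_rational_hodge_cup_ne_zero hX hI hHR c hc hH hne

/-- **BFNP Lemma 50 (the named fact) from hard Lefschetz + Hodge–Riemann, the independence of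
Hodge types from the model, and the semialgebraic triangulation theorem.** The printed proof line,
now with EVERY input a statement of the tree: "By Poincaré duality and the Hodge–Riemann bilinear
relations" = `pairing_of_hardLefschetz_hodgeRiemann` (this file; inputs: the hard Lefschetz datum with
Hodge–Riemann anisotropy, and `hodgePQ_independent_of_hodgeModel`); "`α = Σ aᵢ [Zᵢ]` … `ζ ∪ [Zᵢ] ≠ 0`
… equivalently `0 ≠ ζ|_{Zᵢ}` … Lemma 49" = `hodgeSectionRestriction_of_hodgeConjectureFor_of_pairing_of_c1Triangulation`
(file `HodgeSectionRestrictionTriangulable`; input: `OhmotoShiota2017_c1Triangulation`, giving the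
local contractibility, hence tautness, of `Zᵢ(ℂ)`).
[cite: BrosnanFangNiePearlstein2009, §6 Lemma 50] [cite: VoisinHodgeI2002, Thm. 6.25 and Thm. 6.32]
[cite: OhmotoShiota2017, Thm. 1.1] -/
theorem hodgeSectionRestriction_of_hodgeConjectureFor_of_hardLefschetz_hodgeRiemann_of_c1Triangulation
    (hI : hodgePQ_independent_of_hodgeModel)
    (hHLR : ∀ ⦃n : ℕ⦄ ⦃X : Motives.SchemeOver ℂ⦄, 0 < n → Motives.IsSmoothProjective (2 * n) X →
      ∃ Λ : HardLefschetzNFold (2 * n) X,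
        ∀ (m r : ℕ) (hmr : m + r = n) (y : complexBetti X (2 * m)), IsRationalClass y →
          IsOfHodgeType (2 * n) X (2 * m) m m y →
          Λ.L (2 * r + 1) (2 * m) (2 * m + 2 * (2 * r + 1)) rfl y = 0 → y ≠ 0 →
          cupProduct (rfl : 2 * n + 2 * n = 2 * n + 2 * n)
            (Λ.L r (2 * m) (2 * n) (by omega) y) (Λ.L r (2 * m) (2 * n) (by omega) y) ≠ 0)
    (hOS : Literature.ModelTheory.ExponentialFields.OhmotoShiota2017_c1Triangulation) :
    hodgeSectionRestriction_of_hodgeConjectureFor :=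
  hodgeSectionRestriction_of_hodgeConjectureFor_of_pairing_of_c1Triangulation
    (pairing_of_hardLefschetz_hodgeRiemann hI hHLR) hOS

/-- **The same with (LC) for the supports as a hypothesis in place of the triangulation theorem**
(via `hodgeSectionRestriction_of_hodgeConjectureFor_of_pairing_of_locallyContractibleSupports`):
the fact from hard Lefschetz + Hodge–Riemann, `hodgePQ_independent_of_hodgeModel`, and the local
contractibility of `Z(ℂ)` for the Zariski-closed `Z` of codimension `≥ n` in smooth projective
`2n`-folds. [cite: BrosnanFangNiePearlstein2009, §6 Lemma 50] [cite: VoisinHodgeI2002, Thm. 6.25 and Thm. 6.32] -/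
theorem hodgeSectionRestriction_of_hodgeConjectureFor_of_hardLefschetz_hodgeRiemann_of_locallyContractibleSupports
    (hI : hodgePQ_independent_of_hodgeModel)
    (hHLR : ∀ ⦃n : ℕ⦄ ⦃X : Motives.SchemeOver ℂ⦄, 0 < n → Motives.IsSmoothProjective (2 * n) X →
      ∃ Λ : HardLefschetzNFold (2 * n) X,
        ∀ (m r : ℕ) (hmr : m + r = n) (y : complexBetti X (2 * m)), IsRationalClass y →
          IsOfHodgeType (2 * n) X (2 * m) m m y →
          Λ.L (2 * r + 1) (2 * m) (2 * m + 2 * (2 * r + 1)) rfl y = 0 → y ≠ 0 →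
          cupProduct (rfl : 2 * n + 2 * n = 2 * n + 2 * n)
            (Λ.L r (2 * m) (2 * n) (by omega) y) (Λ.L r (2 * m) (2 * n) (by omega) y) ≠ 0)
    (hLC : ∀ ⦃n : ℕ⦄ ⦃X : Motives.SchemeOver ℂ⦄, 0 < n → Motives.IsSmoothProjective (2 * n) X →
      ∀ Z : Set X.left, IsClosed Z → (∀ z ∈ Z, (n : ℕ∞) ≤ Order.coheight z) →
        LocallyContractibleSpace {P : Motives.ComplexPoints X // P.pt ∈ Z}) :
    hodgeSectionRestriction_of_hodgeConjectureFor :=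
  hodgeSectionRestriction_of_hodgeConjectureFor_of_pairing_of_locallyContractibleSupports
    (pairing_of_hardLefschetz_hodgeRiemann hI hHLR) hLC

/-- **The fourfold case for one `X`** (the statement of the landing pad
`Summit.HodgeConjecture.HodgeConjecture.Theses.HeightMassDefect.SectionRestrictionFourfold` for `X`):
for a smooth projective fourfold `X` satisfying the Hodge conjecture, carrying a hard Lefschetz datum
`Λ` with the Hodge–Riemann anisotropy (`n = 2`: on `H⁴`, `H²`, `H⁰`), granted
`hodgePQ_independent_of_hodgeModel` and the triangulation theorem, every non-zero rational
`(2,2)`-class restricts non-trivially to some hypersurface section.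
[cite: BrosnanFangNiePearlstein2009, §6 Lemma 50] [cite: VoisinHodgeI2002, Thm. 6.25 and Thm. 6.32] -/
theorem sectionRestriction_fourfold_of_hardLefschetz_hodgeRiemann_of_c1Triangulation
    (hX : Motives.IsSmoothProjective 4 X) (hHC : HodgeConjectureFor 4 X)
    (Λ : HardLefschetzNFold (2 * 2) X) (hI : hodgePQ_independent_of_hodgeModel)
    (hHR : ∀ (m r : ℕ) (hmr : m + r = 2) (y : complexBetti X (2 * m)), IsRationalClass y →
      IsOfHodgeType (2 * 2) X (2 * m) m m y →
      Λ.L (2 * r + 1) (2 * m) (2 * m + 2 * (2 * r + 1)) rfl y = 0 → y ≠ 0 →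
      cupProduct (rfl : 2 * 2 + 2 * 2 = 2 * 2 + 2 * 2)
        (Λ.L r (2 * m) (2 * 2) (by omega) y) (Λ.L r (2 * m) (2 * 2) (by omega) y) ≠ 0)
    (hOS : Literature.ModelTheory.ExponentialFields.OhmotoShiota2017_c1Triangulation)
    (e : Motives.ProjectiveEmbedding X) (c : complexBetti X 4) (hc : IsRationalClass c)
    (h22 : IsOfHodgeType 4 X 4 2 2 c) (hne : c ≠ 0) :
    ∃ (k : ℕ) (F : MvPolynomial (Fin (e.n + 1)) ℂ) (Z : Set X.left), 0 < k ∧ F.IsHomogeneous k ∧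
      Z = e.ι.left.base ⁻¹' (letI := MvPolynomial.gradedAlgebra (σ := Fin (e.n + 1)) (R := ℂ);
        ProjectiveSpectrum.zeroLocus (MvPolynomial.homogeneousSubmodule (Fin (e.n + 1)) ℂ) {F}) ∧
      Z ≠ Set.univ ∧
      singularCohomology.map ℂ ℂ
        (⟨Subtype.val, continuous_subtype_val⟩ :
          C({P : Motives.ComplexPoints X // P.pt ∈ Z}, Motives.ComplexPoints X)) 4 c ≠ 0 :=
  exists_sectionRestriction_ne_zero_of_pairing_of_locallyContractible (n := 2) two_pos hX hHC
    (fun c hc hH hne ↦ Λ.exists_rational_hodge_cup_ne_zero (n := 2) hX hI hHR c hc hH hne)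
    (locallyContractibleSpace_complexPoints_of_isSmoothProjective_of_c1Triangulation hOS hX)
    e c hc h22 hne

end Glue

/-! ### (S5) The pairing with an ALGEBRAIC partner: hard Lefschetz + the Hodge index theorem for primitive algebraic classes + the Hodge conjecture for `X` (no comparison of Hodge models) -/

section AlgebraicPairing

variable {n : ℕ} {X : Motives.SchemeOver ℂ}

/-- Transport of the vanishing of a cup product along an equality of target degrees: for
`h : p + q = s` and `h' : p + q = s'`, `cupProduct h u v = 0 ↔ cupProduct h' u v = 0` (both are the
class `u ∪ v`, read in `Hˢ` and `H^{s'}`, `s = p + q = s'`). [folklore] -/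
theorem cupProduct_eq_zero_iff_of_degree_eq {Y : Type u} [TopologicalSpace Y] {R : Type v}
    [CommRing R] {p q s s' : ℕ} (h : p + q = s) (h' : p + q = s') (u : singularCohomology R R Y p)
    (v : singularCohomology R R Y q) : cupProduct h u v = 0 ↔ cupProduct h' u v = 0 := by
  subst h
  subst h'
  exact Iff.rfl

/-- `Lʲ(Nˡ H²ˡ) ⊆ N^q H^{2q}` for `l + j = q` (`Λ.L_mem_algebraicClasses_of_mem` with the target
codimension as a variable). [cite: VoisinHodgeII2003, §9.2.4 Prop. 9.20] -/
theorem HardLefschetzNFold.L_mem_algebraicClasses {d : ℕ} (Λ : HardLefschetzNFold d X)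
    (j l q : ℕ) (hq : l + j = q) (hm : 2 * l + 2 * j = 2 * q) {c : complexBetti X (2 * l)}
    (hc : c ∈ algebraicClasses X l) : Λ.L j (2 * l) (2 * q) hm c ∈ algebraicClasses X q := by
  subst hq
  exact Λ.L_mem_algebraicClasses_of_mem j l hm hc

/-- **Non-degeneracy of the cup product on Hodge classes along the Lefschetz decomposition,
algebraic form — no comparison of Hodge models.** Let `X` be smooth projective of dimension `2n`
with hard Lefschetz datum `Λ` (`L = [H] ∪ ·`), satisfying the cycle part of the Hodge conjecture
(`hHC`: rational `(p,p)`-classes are algebraic, every `p` — a HYPOTHESIS of BFNP Lemma 50) and the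
**Hodge index theorem for primitive algebraic classes** w.r.t. `Λ` (`hHdg`, Grothendieck's standard
conjecture of Hodge type `Hdg(X)` for `[H]`, a theorem over `ℂ` by the Hodge–Riemann bilinear
relations, Voisin I Thm. 6.32; Kleiman 1968 §3; middle degree: Hartshorne App. A Thm. 5.2 "`Y.H ∼_hom 0`,
`Y ≁_hom 0` ⟹ `(-1)ᵏ Y² > 0`"; rendered sign-free: for `2p + r = 2n` and `x ∈ H^{2p}(X(ℂ); ℂ)`
RATIONAL, ALGEBRAIC, primitive (`L^{r+1} x = 0`) and non-zero, `x ∪ Lʳ x ≠ 0` in `H^{4n}`). Then for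
`m + r = n` and every non-zero rational `x ∈ H^{2m}(X(ℂ); ℂ)` of type `(m, m)` there is a rational
ALGEBRAIC class `a ∈ Nⁿ H^{2n}` with `Lʳ x ∪ a ≠ 0`. The induction of `exists_cup_lefschetzPow_ne_zero`
(Voisin I Cor. 6.26: `x = x₀ + Lβ` with `x₀` primitive; partner `Lʳ x₀` if `x₀ ≠ 0` — the cross term
`L^{r+1} β ∪ Lʳ x₀ = β ∪ L^{2r+1} x₀` vanishes — else `Lʳ x = L^{r+1} β` and recurse on `β ≠ 0`), with
different invariants: `x` and `β` are carried as "rational of type `(m, m)`" (both transported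
through the bijection `L^{2r+2} : H^{2m} ≅ H^{4n-2m}`, `Λ.isRationalClass_L_iff`,
`Λ.isOfHodgeType_L_iff`), hence ALGEBRAIC by `hHC`, while the difference `x₀ = x - Lβ` is carried as
"rational and algebraic" only (the algebraic classes form a submodule stable under `L`,
`Λ.lefschetzOperator_mem_algebraicClasses`) — which is all that `hHdg` and the conclusion ask. So
neither a Hodge type for `x₀` nor the named fact `hodgePQ_independent_of_hodgeModel` is needed, and
positivity is used on algebraic classes only. Base `m = 0`: every class of `H⁰` is primitive
(`H^{4n+2}(X(ℂ); ℂ) = 0`). [cite: VoisinHodgeI2002, §6.2.3 Cor. 6.26 and §6.3.2 Thm. 6.32]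
[cite: Kleiman1968, §3] [cite: Hartshorne1977, App. A Thm. 5.2]
[cite: BrosnanFangNiePearlstein2009, §6 display (6.1)] -/
theorem HardLefschetzNFold.exists_algebraic_cup_lefschetzPow_ne_zero
    (hX : Motives.IsSmoothProjective (2 * n) X) (Λ : HardLefschetzNFold (2 * n) X)
    (hHC : ∀ (p : ℕ) (c : complexBetti X (2 * p)), IsRationalClass c →
      IsOfHodgeType (2 * n) X (2 * p) p p c → c ∈ algebraicClasses X p)
    (hHdg : ∀ (p r : ℕ) (hpr : 2 * p + r = 2 * n) (x : complexBetti X (2 * p)), IsRationalClass x →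
      x ∈ algebraicClasses X p → x ≠ 0 →
      Λ.L (r + 1) (2 * p) (2 * p + 2 * (r + 1)) rfl x = 0 →
      cupProduct (by omega : 2 * p + (2 * p + 2 * r) = 2 * (2 * n)) x
        (Λ.L r (2 * p) (2 * p + 2 * r) rfl x) ≠ 0) :
    ∀ (m r : ℕ) (hmr : m + r = n) (x : complexBetti X (2 * m)), IsRationalClass x →
      IsOfHodgeType (2 * n) X (2 * m) m m x → x ≠ 0 →
      ∃ a : complexBetti X (2 * n), IsRationalClass a ∧ a ∈ algebraicClasses X n ∧
        cupProduct (rfl : 2 * n + 2 * n = 2 * n + 2 * n) (Λ.L r (2 * m) (2 * n) (by omega) x) a ≠ 0 := by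
  intro m
  induction m with
  | zero =>
    intro r hmr x hxQ hxT hx0
    obtain rfl : r = n := by omega
    -- every class of `H⁰` is primitive: `H^{4r+2}(X(ℂ); ℂ) = 0`
    have hprim : Λ.L (2 * r + 1) (2 * 0) (2 * 0 + 2 * (2 * r + 1)) rfl x = 0 := by
      haveI := Motives.ComplexPoints.subsingleton_singularCohomology_of_lt hX ℂ
        (k := 2 * 0 + 2 * (2 * r + 1)) (by omega)
      exact Subsingleton.elim _ _
    have hxN : x ∈ algebraicClasses X 0 := hHC 0 x hxQ hxT
    -- Hodge index for `p = 0`: `x ∪ L^{2r} x ≠ 0`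
    have hH := hHdg 0 (2 * r) (by omega) x hxQ hxN hx0 hprim
    refine ⟨Λ.L r (2 * 0) (2 * r) (by omega) x, Λ.isRationalClass_L _ _ _ _ hxQ,
      Λ.L_mem_algebraicClasses r 0 r (by omega) (by omega) hxN, ?_⟩
    intro h0
    apply hH
    simp only [HardLefschetzNFold.L] at h0 ⊢
    rw [cupProduct_lefschetzPowTo_lefschetzPowTo Λ.hyperplaneClass r r (by omega) (by omega) rfl
        (by omega : 2 * 0 + 2 * (r + r) = 2 * 0 + 2 * (2 * r)) (by omega) x x,
      lefschetzPowTo_congr_exponent Λ.hyperplaneClass (by omega : r + r = 2 * r) _ rfl x] at h0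
    exact (cupProduct_eq_zero_iff_of_degree_eq _ _ x _).1 h0
  | succ m ih =>
    intro r hmr x hxQ hxT hx0
    -- the Lefschetz decomposition step: `x = x₀ + Lβ`, `L^{2r+1} x₀ = 0`
    obtain ⟨x₀, β, hx, hprim, hQ, -⟩ := Λ.exists_eq_primitive_add_lefschetzOperator
      (k := 2 * m) (j := 2 * r + 1) (l := 2 * (m + 1)) (t := 2 * (m + 1) + 2 * (2 * r + 1))
      (by omega) (two_add_two_mul m) rfl x
    obtain ⟨hx₀Q, hβQ⟩ := hQ hxQ
    -- `L^{2r+2} β = L^{2r+1} x`, so `β` is of type `(m, m)` (`L^{2r+2} : H^{2m} → H^{4n-2m}` detects types)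
    have hLx : Λ.L (2 * r + 1) (2 * (m + 1)) (2 * (m + 1) + 2 * (2 * r + 1)) rfl x =
        Λ.L (2 * r + 1 + 1) (2 * m) (2 * (m + 1) + 2 * (2 * r + 1)) (by omega) β := by
      conv_lhs => rw [hx]
      rw [map_add, hprim, zero_add]
      exact lefschetzPowTo_lefschetzOperator Λ.hyperplaneClass (2 * r + 1) (two_add_two_mul m) rfl
        (by omega) β
    have hβT : IsOfHodgeType (2 * n) X (2 * m) m m β := by
      have h1 := Λ.isOfHodgeType_L (2 * r + 1) (2 * (m + 1)) (2 * (m + 1) + 2 * (2 * r + 1)) rfl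
        (m + 1) (m + 1) hxT
      rw [hLx] at h1
      refine (Λ.isOfHodgeType_L_iff (j := 2 * r + 1 + 1) (k := 2 * m) (by omega)
        (2 * (m + 1) + 2 * (2 * r + 1)) (by omega) m m β).1 ?_
      rwa [show m + (2 * r + 1 + 1) = m + 1 + (2 * r + 1) by omega]
    -- algebraicity: `x`, `β` by the Hodge conjecture for `X`; `x₀ = x - Lβ` as a difference
    have hxN : x ∈ algebraicClasses X (m + 1) := hHC (m + 1) x hxQ hxT
    have hβN : β ∈ algebraicClasses X m := hHC m β hβQ hβT
    have hx₀N : x₀ ∈ algebraicClasses X (m + 1) := by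
      have hx₀ : x₀ = x - lefschetzOperator Λ.hyperplaneClass (two_add_two_mul m) β := by
        rw [hx, add_sub_cancel_right]
      rw [hx₀]
      exact Submodule.sub_mem _ hxN (Λ.lefschetzOperator_mem_algebraicClasses m β hβN)
    by_cases hx₀ : x₀ = 0
    · -- `x = Lβ`, `β ≠ 0`: induction
      subst hx₀
      rw [zero_add] at hx
      have hβ0 : β ≠ 0 := by
        rintro rfl
        exact hx0 (by rw [hx, map_zero])
      obtain ⟨a, haQ, haN, hne⟩ := ih (r + 1) (by omega) β hβQ hβT hβ0
      refine ⟨a, haQ, haN, ?_⟩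
      rw [hx]
      simp only [HardLefschetzNFold.L] at hne ⊢
      rwa [lefschetzPowTo_lefschetzOperator Λ.hyperplaneClass r (two_add_two_mul m) (by omega)
        (by omega) β]
    · -- `x₀ ≠ 0`: the partner is `Lʳ x₀`; Hodge index for the primitive algebraic class `x₀`
      have hH := hHdg (m + 1) (2 * r) (by omega) x₀ hx₀Q hx₀N hx₀ hprim
      set a := Λ.L r (2 * (m + 1)) (2 * n) (by omega) x₀ with ha
      have haQ : IsRationalClass a := Λ.isRationalClass_L _ _ _ _ hx₀Q
      have haN : a ∈ algebraicClasses X n :=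
        Λ.L_mem_algebraicClasses r (m + 1) n (by omega) (by omega) hx₀N
      refine ⟨a, haQ, haN, ?_⟩
      -- `Lʳ x = a + L^{r+1} β`
      have hLx' : Λ.L r (2 * (m + 1)) (2 * n) (by omega) x =
          a + Λ.L (r + 1) (2 * m) (2 * n) (by omega) β := by
        rw [hx, map_add, ha]
        simp only [HardLefschetzNFold.L]
        rw [lefschetzPowTo_lefschetzOperator Λ.hyperplaneClass r (two_add_two_mul m) (by omega)
          (by omega) β]
      -- the cross term `L^{r+1} β ∪ Lʳ x₀ = β ∪ L^{2r+1} x₀ = 0`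
      have hcross : cupProduct (rfl : 2 * n + 2 * n = 2 * n + 2 * n)
          (Λ.L (r + 1) (2 * m) (2 * n) (by omega) β) a = 0 := by
        rw [ha]
        simp only [HardLefschetzNFold.L] at hprim ⊢
        rw [cupProduct_lefschetzPowTo_lefschetzPowTo Λ.hyperplaneClass (r + 1) r (by omega) (by omega)
            rfl (by omega : 2 * (m + 1) + 2 * (r + 1 + r) = 2 * (m + 1) + 2 * (2 * r + 1))
            (by omega) β x₀,
          lefschetzPowTo_congr_exponent Λ.hyperplaneClass (by omega : r + 1 + r = 2 * r + 1) _ rfl x₀,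
          hprim, map_zero]
      rw [hLx', map_add, LinearMap.add_apply, hcross, add_zero]
      -- `a ∪ a = x₀ ∪ L^{2r} x₀ ≠ 0`
      intro h0
      apply hH
      rw [ha] at h0
      simp only [HardLefschetzNFold.L] at h0 ⊢
      rw [cupProduct_lefschetzPowTo_lefschetzPowTo Λ.hyperplaneClass r r (by omega) (by omega) rfl
          (by omega : 2 * (m + 1) + 2 * (r + r) = 2 * (m + 1) + 2 * (2 * r)) (by omega) x₀ x₀,
        lefschetzPowTo_congr_exponent Λ.hyperplaneClass (by omega : r + r = 2 * r) _ rfl x₀] at h0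
      exact (cupProduct_eq_zero_iff_of_degree_eq _ _ x₀ _).1 h0

/-- **(P) with an algebraic partner.** For `X` smooth projective of dimension `2n` with hard
Lefschetz datum `Λ` satisfying the Hodge index theorem for primitive algebraic classes, and the cycle
part of the Hodge conjecture for `X`, every non-zero rational `(n, n)`-class `c ∈ H^{2n}(X(ℂ); ℂ)` has
a rational ALGEBRAIC partner `a ∈ Nⁿ H^{2n}(X(ℂ); ℂ)` with `c ∪ a ≠ 0` — BFNP's "there is
`α ∈ Hdg^{2n}(X)` with `0 ≠ α ∪ ζ` … `α = Σ aᵢ [Zᵢ]`" in one step (`exists_algebraic_cup_lefschetzPow_ne_zero`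
at `m = n`, `r = 0`). [cite: BrosnanFangNiePearlstein2009, §6 display (6.1) and proof of Lemma 50]
[cite: Kleiman1968, §3] -/
theorem HardLefschetzNFold.exists_algebraic_cup_ne_zero
    (hX : Motives.IsSmoothProjective (2 * n) X) (Λ : HardLefschetzNFold (2 * n) X)
    (hHC : ∀ (p : ℕ) (c : complexBetti X (2 * p)), IsRationalClass c →
      IsOfHodgeType (2 * n) X (2 * p) p p c → c ∈ algebraicClasses X p)
    (hHdg : ∀ (p r : ℕ) (hpr : 2 * p + r = 2 * n) (x : complexBetti X (2 * p)), IsRationalClass x →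
      x ∈ algebraicClasses X p → x ≠ 0 →
      Λ.L (r + 1) (2 * p) (2 * p + 2 * (r + 1)) rfl x = 0 →
      cupProduct (by omega : 2 * p + (2 * p + 2 * r) = 2 * (2 * n)) x
        (Λ.L r (2 * p) (2 * p + 2 * r) rfl x) ≠ 0)
    (c : complexBetti X (2 * n)) (hc : IsRationalClass c) (hH : IsOfHodgeType (2 * n) X (2 * n) n n c)
    (hne : c ≠ 0) :
    ∃ a : complexBetti X (2 * n), IsRationalClass a ∧ a ∈ algebraicClasses X n ∧
      cupProduct (rfl : 2 * n + 2 * n = 2 * n + 2 * n) c a ≠ 0 :=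
  Λ.exists_algebraic_cup_lefschetzPow_ne_zero hX hHC hHdg n 0 (by omega) c hc hH hne

/-- **BFNP Lemma 50 for one `2n`-fold from hard Lefschetz + the Hodge index theorem for primitive
algebraic classes, the Hodge conjecture for `X`, and (LC).** For `X` smooth projective of dimension
`2n ≥ 2` satisfying the Hodge conjecture, carrying a hard Lefschetz datum `Λ` with the Hodge index
property on primitive algebraic classes, and with `Z(ℂ)` locally contractible for every
Zariski-closed `Z ⊆ X`, every non-zero rational `(n, n)`-class restricts non-trivially to some
hypersurface section (`exists_algebraic_cup_ne_zero` + the topological core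
`exists_sectionRestriction_ne_zero_of_cup_ne_zero_of_locallyContractible`).
[cite: BrosnanFangNiePearlstein2009, §6 Lemma 50] [cite: Kleiman1968, §3] -/
theorem exists_sectionRestriction_ne_zero_of_hodgeIndex_of_locallyContractible (hn : 0 < n)
    (hX : Motives.IsSmoothProjective (2 * n) X) (hHC : HodgeConjectureFor (2 * n) X)
    (Λ : HardLefschetzNFold (2 * n) X)
    (hHdg : ∀ (p r : ℕ) (hpr : 2 * p + r = 2 * n) (x : complexBetti X (2 * p)), IsRationalClass x →
      x ∈ algebraicClasses X p → x ≠ 0 →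
      Λ.L (r + 1) (2 * p) (2 * p + 2 * (r + 1)) rfl x = 0 →
      cupProduct (by omega : 2 * p + (2 * p + 2 * r) = 2 * (2 * n)) x
        (Λ.L r (2 * p) (2 * p + 2 * r) rfl x) ≠ 0)
    (hLC : ∀ Z : Set X.left, IsClosed Z →
      LocallyContractibleSpace {P : Motives.ComplexPoints X // P.pt ∈ Z})
    (e : Motives.ProjectiveEmbedding X) (c : complexBetti X (2 * n)) (hc : IsRationalClass c)
    (hH : IsOfHodgeType (2 * n) X (2 * n) n n c) (hne : c ≠ 0) :
    ∃ (k : ℕ) (F : MvPolynomial (Fin (e.n + 1)) ℂ) (Z : Set X.left), 0 < k ∧ F.IsHomogeneous k ∧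
      Z = e.ι.left.base ⁻¹' (letI := MvPolynomial.gradedAlgebra (σ := Fin (e.n + 1)) (R := ℂ);
        ProjectiveSpectrum.zeroLocus (MvPolynomial.homogeneousSubmodule (Fin (e.n + 1)) ℂ) {F}) ∧
      Z ≠ Set.univ ∧
      singularCohomology.map ℂ ℂ
        (⟨Subtype.val, continuous_subtype_val⟩ :
          C({P : Motives.ComplexPoints X // P.pt ∈ Z}, Motives.ComplexPoints X)) (2 * n) c ≠ 0 := by
  obtain ⟨a, -, haN, hca⟩ := Λ.exists_algebraic_cup_ne_zero hX hHC.2 hHdg c hc hH hne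
  exact exists_sectionRestriction_ne_zero_of_cup_ne_zero_of_locallyContractible hn hX hLC e haN hca

/-- **BFNP Lemma 50 (the named fact) from hard Lefschetz + the Hodge index theorem for primitive
algebraic classes on every even-dimensional smooth projective variety, and the semialgebraic
triangulation theorem** — WITHOUT `hodgePQ_independent_of_hodgeModel`. The printed proof line with
two inputs: "By Poincaré duality and the Hodge–Riemann bilinear relations … by the Hodge conjecture
for `X`, `α = Σ aᵢ [Zᵢ]`" = `HardLefschetzNFold.exists_algebraic_cup_ne_zero` (input `hHdg`: for every
smooth projective `X` of dimension `2n ≥ 2` a hard Lefschetz datum — Voisin I Thm. 6.25, the content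
of `nonempty_hardLefschetzNFold (2n) X` — satisfying Grothendieck's `Hdg(X)` for its class, sign-free,
a theorem over `ℂ` by Voisin I Thm. 6.32 / Kleiman 1968 §3); "`ζ ∪ [Zᵢ] ≠ 0` … equivalently
`0 ≠ ζ|_{Zᵢ}` … Lemma 49" = the topological core with (LC) from `OhmotoShiota2017_c1Triangulation`
(`locallyContractibleSpace_complexPoints_of_isSmoothProjective_of_c1Triangulation`).
[cite: BrosnanFangNiePearlstein2009, §6 Lemma 50] [cite: Kleiman1968, §3]
[cite: VoisinHodgeI2002, Thm. 6.25 and Thm. 6.32] [cite: OhmotoShiota2017, Thm. 1.1] -/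
theorem hodgeSectionRestriction_of_hodgeConjectureFor_of_hodgeIndex_of_c1Triangulation
    (hHdg : ∀ ⦃n : ℕ⦄ ⦃X : Motives.SchemeOver ℂ⦄, 0 < n → Motives.IsSmoothProjective (2 * n) X →
      ∃ Λ : HardLefschetzNFold (2 * n) X,
        ∀ (p r : ℕ) (hpr : 2 * p + r = 2 * n) (x : complexBetti X (2 * p)), IsRationalClass x →
          x ∈ algebraicClasses X p → x ≠ 0 →
          Λ.L (r + 1) (2 * p) (2 * p + 2 * (r + 1)) rfl x = 0 →
          cupProduct (by omega : 2 * p + (2 * p + 2 * r) = 2 * (2 * n)) x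
            (Λ.L r (2 * p) (2 * p + 2 * r) rfl x) ≠ 0)
    (hOS : Literature.ModelTheory.ExponentialFields.OhmotoShiota2017_c1Triangulation) :
    hodgeSectionRestriction_of_hodgeConjectureFor := by
  intro n X hn hX hHC e c hc hH hne
  obtain ⟨Λ, hΛ⟩ := hHdg hn hX
  exact exists_sectionRestriction_ne_zero_of_hodgeIndex_of_locallyContractible hn hX hHC Λ hΛ
    (locallyContractibleSpace_complexPoints_of_isSmoothProjective_of_c1Triangulation hOS hX) e c hc hH hne

/-- **The same with (LC) for the supports as a hypothesis in place of the triangulation theorem**: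
the fact from hard Lefschetz + the Hodge index theorem for primitive algebraic classes, and the
local contractibility of `Z(ℂ)` for the Zariski-closed `Z` of codimension `≥ n` in smooth projective
`2n`-folds (the support form of the topological core,
`forall_le_exists_sectionRestriction_ne_zero_of_cup_ne_zero`, fed by the algebraic partner).
[cite: BrosnanFangNiePearlstein2009, §6 Lemma 50] [cite: Kleiman1968, §3] -/
theorem hodgeSectionRestriction_of_hodgeConjectureFor_of_hodgeIndex_of_locallyContractibleSupports
    (hHdg : ∀ ⦃n : ℕ⦄ ⦃X : Motives.SchemeOver ℂ⦄, 0 < n → Motives.IsSmoothProjective (2 * n) X →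
      ∃ Λ : HardLefschetzNFold (2 * n) X,
        ∀ (p r : ℕ) (hpr : 2 * p + r = 2 * n) (x : complexBetti X (2 * p)), IsRationalClass x →
          x ∈ algebraicClasses X p → x ≠ 0 →
          Λ.L (r + 1) (2 * p) (2 * p + 2 * (r + 1)) rfl x = 0 →
          cupProduct (by omega : 2 * p + (2 * p + 2 * r) = 2 * (2 * n)) x
            (Λ.L r (2 * p) (2 * p + 2 * r) rfl x) ≠ 0)
    (hLC : ∀ ⦃n : ℕ⦄ ⦃X : Motives.SchemeOver ℂ⦄, 0 < n → Motives.IsSmoothProjective (2 * n) X →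
      ∀ Z : Set X.left, IsClosed Z → (∀ z ∈ Z, (n : ℕ∞) ≤ Order.coheight z) →
        LocallyContractibleSpace {P : Motives.ComplexPoints X // P.pt ∈ Z}) :
    hodgeSectionRestriction_of_hodgeConjectureFor := by
  intro n X hn hX hHC e c hc hH hne
  obtain ⟨Λ, hΛ⟩ := hHdg hn hX
  obtain ⟨a, -, haN, hca⟩ := Λ.exists_algebraic_cup_ne_zero hX hHC.2 hΛ c hc hH hne
  obtain ⟨k₀, hk₀, hk⟩ := forall_le_exists_sectionRestriction_ne_zero_of_cup_ne_zero hn hX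
    (fun Z hZ hcodim c hc ↦
      exists_isOpen_map_eq_zero_of_locallyContractibleSpace hX hZ (hLC hn hX Z hZ hcodim) c hc)
    e haN hca
  obtain ⟨F, Z, hFk, hZ, hZu, hcZ⟩ := hk k₀ le_rfl
  exact ⟨k₀, F, Z, hk₀, hFk, hZ, hZu, hcZ⟩

/-- **The fourfold case for one `X`** (the statement of the landing pad
`Summit.HodgeConjecture.HodgeConjecture.Theses.HeightMassDefect.SectionRestrictionFourfold` for `X`):
for a smooth projective fourfold `X` satisfying the Hodge conjecture and carrying a hard Lefschetz
datum `Λ` with the Hodge index property on primitive algebraic classes (`n = 2`: on `N² H⁴`, `N¹ H²`,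
`N⁰ H⁰`), granted the triangulation theorem, every non-zero rational `(2,2)`-class restricts
non-trivially to some hypersurface section. [cite: BrosnanFangNiePearlstein2009, §6 Lemma 50]
[cite: Kleiman1968, §3] -/
theorem sectionRestriction_fourfold_of_hodgeIndex_of_c1Triangulation
    (hX : Motives.IsSmoothProjective 4 X) (hHC : HodgeConjectureFor 4 X)
    (Λ : HardLefschetzNFold (2 * 2) X)
    (hHdg : ∀ (p r : ℕ) (hpr : 2 * p + r = 2 * 2) (x : complexBetti X (2 * p)), IsRationalClass x →
      x ∈ algebraicClasses X p → x ≠ 0 →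
      Λ.L (r + 1) (2 * p) (2 * p + 2 * (r + 1)) rfl x = 0 →
      cupProduct (by omega : 2 * p + (2 * p + 2 * r) = 2 * (2 * 2)) x
        (Λ.L r (2 * p) (2 * p + 2 * r) rfl x) ≠ 0)
    (hOS : Literature.ModelTheory.ExponentialFields.OhmotoShiota2017_c1Triangulation)
    (e : Motives.ProjectiveEmbedding X) (c : complexBetti X 4) (hc : IsRationalClass c)
    (h22 : IsOfHodgeType 4 X 4 2 2 c) (hne : c ≠ 0) :
    ∃ (k : ℕ) (F : MvPolynomial (Fin (e.n + 1)) ℂ) (Z : Set X.left), 0 < k ∧ F.IsHomogeneous k ∧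
      Z = e.ι.left.base ⁻¹' (letI := MvPolynomial.gradedAlgebra (σ := Fin (e.n + 1)) (R := ℂ);
        ProjectiveSpectrum.zeroLocus (MvPolynomial.homogeneousSubmodule (Fin (e.n + 1)) ℂ) {F}) ∧
      Z ≠ Set.univ ∧
      singularCohomology.map ℂ ℂ
        (⟨Subtype.val, continuous_subtype_val⟩ :
          C({P : Motives.ComplexPoints X // P.pt ∈ Z}, Motives.ComplexPoints X)) 4 c ≠ 0 :=
  exists_sectionRestriction_ne_zero_of_hodgeIndex_of_locallyContractible (n := 2) two_pos hX hHC Λ hHdg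
    (locallyContractibleSpace_complexPoints_of_isSmoothProjective_of_c1Triangulation hOS hX)
    e c hc h22 hne

end AlgebraicPairing

/-! ### (S6) BFNP Lemma 50 from NAMED FACTS of the tree only: `hodgeIndex_primitiveAlgebraic` + `OhmotoShiota2017_c1Triangulation` -/

section FromFacts

variable {X : Motives.SchemeOver ℂ}

/-- **BFNP Lemma 50 (the named fact `hodgeSectionRestriction_of_hodgeConjectureFor`) from two named
facts of the tree**: the Hodge index theorem for primitive algebraic classes on smooth projective
complex varieties (`hodgeIndex_primitiveAlgebraic`, file `HodgeIndexPrimitiveAlgebraic`: hard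
Lefschetz + Grothendieck's `Hdg(X)` over `ℂ`, Kleiman 1968 §3 / Voisin I Thm. 6.25, 6.32) and the
semialgebraic triangulation theorem (`OhmotoShiota2017_c1Triangulation`). The discharge
`hodgeSectionRestriction_of_hodgeConjectureFor_holds` is this theorem applied to their `_holds`.
[cite: BrosnanFangNiePearlstein2009, §6 Lemma 50] [cite: Kleiman1968, §3]
[cite: VoisinHodgeI2002, Thm. 6.25 and Thm. 6.32] [cite: OhmotoShiota2017, Thm. 1.1] -/
theorem hodgeSectionRestriction_of_hodgeConjectureFor_of_hodgeIndexFact_of_c1Triangulation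
    (hHdg : ∀ (n : ℕ) (X : Motives.SchemeOver ℂ), hodgeIndex_primitiveAlgebraic n X)
    (hOS : Literature.ModelTheory.ExponentialFields.OhmotoShiota2017_c1Triangulation) :
    hodgeSectionRestriction_of_hodgeConjectureFor :=
  hodgeSectionRestriction_of_hodgeConjectureFor_of_hodgeIndex_of_c1Triangulation
    (fun n X _ hX ↦ hHdg (2 * n) X hX) hOS

/-- **The same with (LC) of the supports in place of the triangulation theorem.**
[cite: BrosnanFangNiePearlstein2009, §6 Lemma 50] [cite: Kleiman1968, §3] -/
theorem hodgeSectionRestriction_of_hodgeConjectureFor_of_hodgeIndexFact_of_locallyContractibleSupports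
    (hHdg : ∀ (n : ℕ) (X : Motives.SchemeOver ℂ), hodgeIndex_primitiveAlgebraic n X)
    (hLC : ∀ ⦃n : ℕ⦄ ⦃X : Motives.SchemeOver ℂ⦄, 0 < n → Motives.IsSmoothProjective (2 * n) X →
      ∀ Z : Set X.left, IsClosed Z → (∀ z ∈ Z, (n : ℕ∞) ≤ Order.coheight z) →
        LocallyContractibleSpace {P : Motives.ComplexPoints X // P.pt ∈ Z}) :
    hodgeSectionRestriction_of_hodgeConjectureFor :=
  hodgeSectionRestriction_of_hodgeConjectureFor_of_hodgeIndex_of_locallyContractibleSupports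
    (fun n X _ hX ↦ hHdg (2 * n) X hX) hLC

/-- **The fourfold case for one `X` from named facts**: the Hodge conjecture for the smooth projective
fourfold `X`, `hodgeIndex_primitiveAlgebraic 4 X` and the triangulation theorem give the statement of
the landing pad `…Theses.HeightMassDefect.SectionRestrictionFourfold` for `X`.
[cite: BrosnanFangNiePearlstein2009, §6 Lemma 50] [cite: Kleiman1968, §3] -/
theorem sectionRestriction_fourfold_of_hodgeIndexFact_of_c1Triangulation
    (hX : Motives.IsSmoothProjective 4 X) (hHC : HodgeConjectureFor 4 X)
    (hHdg : hodgeIndex_primitiveAlgebraic 4 X)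
    (hOS : Literature.ModelTheory.ExponentialFields.OhmotoShiota2017_c1Triangulation)
    (e : Motives.ProjectiveEmbedding X) (c : complexBetti X 4) (hc : IsRationalClass c)
    (h22 : IsOfHodgeType 4 X 4 2 2 c) (hne : c ≠ 0) :
    ∃ (k : ℕ) (F : MvPolynomial (Fin (e.n + 1)) ℂ) (Z : Set X.left), 0 < k ∧ F.IsHomogeneous k ∧
      Z = e.ι.left.base ⁻¹' (letI := MvPolynomial.gradedAlgebra (σ := Fin (e.n + 1)) (R := ℂ);
        ProjectiveSpectrum.zeroLocus (MvPolynomial.homogeneousSubmodule (Fin (e.n + 1)) ℂ) {F}) ∧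
      Z ≠ Set.univ ∧
      singularCohomology.map ℂ ℂ
        (⟨Subtype.val, continuous_subtype_val⟩ :
          C({P : Motives.ComplexPoints X // P.pt ∈ Z}, Motives.ComplexPoints X)) 4 c ≠ 0 := by
  obtain ⟨Λ, hΛ⟩ := hHdg hX
  exact sectionRestriction_fourfold_of_hodgeIndex_of_c1Triangulation hX hHC Λ hΛ hOS e c hc h22 hne

end FromFacts

end HodgeTheory

end Literature.AlgebraicGeometry.HodgeTheory

end
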